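import Summits.CriticalPhenomena.PercolationContinuityZ3.Theorems.PercNearOneGluingNoHeavyRsw3InBoxGiantDensity
import HarnessLib

/-!
# RSW3 lane (P2, gen 33): THE IN-BOX GIANT, VIII — THE FREE-BOUNDARY IN-BOX GIANT IS AN ORDER PARAMETER WITH THRESHOLD
# EXACTLY `p_c(ℤ^d)` (`d ≥ 3`): a macroscopic open cluster OF THE BOX appears with non-vanishing probability iff `p > p_c`

builds on p205010 (kernel theorem, internal audit signed; external expert review pending) — USED for the boundary case `p = p_c(ℤ^d)`
(`CSH.percolationContinuity_allDimensions`: `θ(p_c(ℤ^d)) = 0` for every `d ≥ 2`), so that `θ ≡ 0` on `[0, p_c]` and the dichotomy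
below is sharp AT `p_c`, not only away from it.

Cell `prim-rsw3`, prover seat `prim-rsw3-p2` (gen 33), memo `run/shared/lean/prim/rsw3/P2-RSWLITE.md` §40.
Support file (`--supports stmt-CriticalPhenomena-17919`); no definitions, no named facts, no sorries.

Notation (inline). `Λ(N) = box d N`, `V_N = (2N+1)^d`; `C^N(x) = {w ∈ Λ(N) : x ↔ w in Λ(N)}`;
`M^in_N = max_{x ∈ Λ(N)} |C^N(x)|` (largest open cluster of the box, free boundary conditions); `M_N = max_x |C(x) ∩ Λ(N)|`.

* §1 **`tendsto_real_le_supInBox_of_theta_eq_zero`** (every `d ≥ 1`, every `p` with `θ(p) = 0`, every `ε > 0`):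
  `P_p(εV_N ≤ M^in_N) → 0` — no macroscopic open cluster in the box (`M^in_N ≤ M_N` and gen 23's `M_N/V_N → θ = 0` in probability);
  **`tendsto_real_le_supInBox_of_le_criticalProb`** — the same for every `p ≤ p_c(ℤ^d)`, `d ≥ 2` (p205010 at `p = p_c`).
* §2 **`tendsto_real_le_supInBox_supercritical`** (`d ≥ 3`, `p > p_c(ℤ^d)`, `ε < θ(p)`): `P_p(εV_N ≤ M^in_N) → 1` (part IV).
* §3 **`exists_frequently_le_real_supInBox_iff`** (`d ≥ 3`): `(∃ ε > 0, ∃ c > 0, ∃ᶠ N, c ≤ P_p(εV_N ≤ M^in_N)) ↔ p_c(ℤ^d) < p` —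
  THE FREE-BOUNDARY IN-BOX GIANT IS AN ORDER PARAMETER WHOSE THRESHOLD IS EXACTLY `p_c(ℤ^d)`; cf. the lane's two-sided
  characterisations of `p_c` by annulus events (lead gen 9 `exists_forall_le_annulusTwoArmProb_iff_eq_criticalProbI`).

References: C. Borgs, J. T. Chayes, H. Kesten, J. Spencer, CMP 224 (2001) Thm. 1.1 (iii) [BorgsChayesKestenSpencer2001];
A. Pisztora, PTRF 104 (1996) [Pisztora1996]; G. Kozma, N. Nitzan (2024) Thm. 6 / Conj. 3 [KozmaNitzan2024]. [folklore]
-/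

noncomputable section

namespace Summit.CriticalPhenomena.PercolationContinuityZ3.Theorems

namespace Rsw3

open MeasureTheory Filter Topology Literature.Probability.LatticeModels Literature.Probability.Percolation
open SimpleGraph Finset

variable {d : ℕ}

/-! ## §1 No in-box giant when `θ(p) = 0` -/

open Classical in
/-- **NO MACROSCOPIC OPEN CLUSTER IN THE BOX WHEN `θ(p) = 0`** (every `d ≥ 1`, every `ε > 0`): `P_p(ε(2N+1)^d ≤ M^in_N) → 0`.
An in-box cluster is part of a cluster of the whole configuration, and `M_N/(2N+1)^d → θ(p) = 0` in probability (gen 23).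
[cite: BorgsChayesKestenSpencer2001, Thm. 1.1] -/
theorem tendsto_real_le_supInBox_of_theta_eq_zero (hd1 : 1 ≤ d) (p : unitInterval)
    (hθ : theta (zdGraph d) (0 : Site d) p = 0) {ε : ℝ} (hε : 0 < ε) :
    Tendsto (fun N : ℕ => (bondPercolation (zdGraph d) p).real {ω | ε * (2 * (N : ℝ) + 1) ^ d ≤
      ((((box d N).sup fun x => ((box d N).filter fun w => ω ∈ inConn ↑(box d N) x w).card : ℕ) : ℝ))}) atTop (𝓝 0) := by
  classical
  have h := tendsto_real_exists_inBox_ge (d := d) hd1 p hε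
  rw [hθ, zero_add] at h
  refine squeeze_zero (fun N => measureReal_nonneg) (fun N => measureReal_mono ?_) h
  intro ω hω
  have hω' : ε * (2 * (N : ℝ) + 1) ^ d ≤
      ((((box d N).sup fun x => ((box d N).filter fun w => ω ∈ inConn ↑(box d N) x w).card : ℕ) : ℝ)) := hω
  obtain ⟨x, hx, hxeq⟩ := Finset.exists_mem_eq_sup (box d N) ⟨0, zero_mem_box d N⟩
    (fun x => ((box d N).filter fun w => ω ∈ inConn ↑(box d N) x w).card)
  refine ⟨x, hx, ?_⟩
  rw [hxeq] at hω'
  exact hω'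

open Classical in
/-- **NO IN-BOX GIANT AT OR BELOW `p_c(ℤ^d)`** (`d ≥ 2`, every `p ≤ p_c(ℤ^d)`, `ε > 0`): `P_p(ε(2N+1)^d ≤ M^in_N) → 0` — below `p_c`
because `θ = 0` there, AT `p_c` because `θ(p_c(ℤ^d)) = 0` (p205010, every `d ≥ 2`).  builds on p205010 (kernel theorem, internal
audit signed; external expert review pending). [cite: KozmaNitzan2024, Thm. 6 with Conj. 3 (p. 15)] -/
theorem tendsto_real_le_supInBox_of_le_criticalProb (hd : 2 ≤ d) (p : unitInterval)
    (hp : (p : ℝ) ≤ criticalProb (zdGraph d) 0) {ε : ℝ} (hε : 0 < ε) :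
    Tendsto (fun N : ℕ => (bondPercolation (zdGraph d) p).real {ω | ε * (2 * (N : ℝ) + 1) ^ d ≤
      ((((box d N).sup fun x => ((box d N).filter fun w => ω ∈ inConn ↑(box d N) x w).card : ℕ) : ℝ))}) atTop (𝓝 0) := by
  refine tendsto_real_le_supInBox_of_theta_eq_zero (by omega) p ?_ hε
  rcases hp.lt_or_eq with hlt | heq
  · exact theta_eq_zero_of_lt_criticalProb_holds (zdGraph d) 0 p hlt
  · have hp' : p = criticalProbI d := Subtype.ext (by rw [coe_criticalProbI]; exact heq)
    rw [hp']
    exact CSH.percolationContinuity_allDimensions d hd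

/-! ## §2 An in-box giant above `p_c(ℤ^d)` -/

open Classical in
/-- **AN IN-BOX GIANT ABOVE `p_c(ℤ^d)`** (`d ≥ 3`, `p > p_c(ℤ^d)`, any `ε < θ(p)`): `P_p(ε(2N+1)^d ≤ M^in_N) → 1` (part IV:
some in-box cluster has `≥ (θ − (θ−ε))(2N+1)^d` sites with probability `→ 1`). [cite: BorgsChayesKestenSpencer2001, Thm. 1.1]
[cite: Pisztora1996, Thm. 1.1] -/
theorem tendsto_real_le_supInBox_supercritical (hd : 3 ≤ d) (p : unitInterval)
    (hp : criticalProb (zdGraph d) 0 < (p : ℝ)) {ε : ℝ} (hεθ : ε < theta (zdGraph d) (0 : Site d) p) :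
    Tendsto (fun N : ℕ => (bondPercolation (zdGraph d) p).real {ω | ε * (2 * (N : ℝ) + 1) ^ d ≤
      ((((box d N).sup fun x => ((box d N).filter fun w => ω ∈ inConn ↑(box d N) x w).card : ℕ) : ℝ))}) atTop (𝓝 1) := by
  classical
  set μ := bondPercolation (zdGraph d) p with hμ
  set θ : ℝ := theta (zdGraph d) (0 : Site d) p with hθ
  have h := tendsto_real_not_exists_inBox_ge hd p hp (show 0 < θ - ε by linarith)
  -- `P(A) = 1 - P(Aᶜ)` with `Aᶜ ⊆` the exceptional event of part IV
  have hmeas : ∀ N : ℕ, MeasurableSet {ω : BondConfig (Site d) | ε * (2 * (N : ℝ) + 1) ^ d ≤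
      ((((box d N).sup fun x => ((box d N).filter fun w => ω ∈ inConn ↑(box d N) x w).card : ℕ) : ℝ))} := by
    intro N
    have heq : {ω : BondConfig (Site d) | ε * (2 * (N : ℝ) + 1) ^ d ≤
        ((((box d N).sup fun x => ((box d N).filter fun w => ω ∈ inConn ↑(box d N) x w).card : ℕ) : ℝ))} =
        ⋃ x ∈ box d N, {ω | ε * (2 * (N : ℝ) + 1) ^ d ≤ (((box d N).filter fun w => ω ∈ inConn ↑(box d N) x w).card : ℝ)} := by
      ext ω
      simp only [Set.mem_setOf_eq, Set.mem_iUnion, exists_prop]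
      constructor
      · intro h
        obtain ⟨x, hx, hxeq⟩ := Finset.exists_mem_eq_sup (box d N) ⟨0, zero_mem_box d N⟩
          (fun x => ((box d N).filter fun w => ω ∈ inConn ↑(box d N) x w).card)
        refine ⟨x, hx, ?_⟩
        rw [hxeq] at h
        exact h
      · rintro ⟨x, hx, h⟩
        refine h.trans ?_
        exact_mod_cast Finset.le_sup (f := fun x => ((box d N).filter fun w => ω ∈ inConn ↑(box d N) x w).card) hx
    rw [heq]
    exact Finset.measurableSet_biUnion _ fun x _ =>
      measurableSet_le measurable_const (measurable_card_filter_mem (box d N) _ fun w _ => measurableSet_inConn _ x w)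
  have hcompl : ∀ N : ℕ, μ.real {ω | ε * (2 * (N : ℝ) + 1) ^ d ≤
      ((((box d N).sup fun x => ((box d N).filter fun w => ω ∈ inConn ↑(box d N) x w).card : ℕ) : ℝ))} =
      1 - μ.real {ω | ε * (2 * (N : ℝ) + 1) ^ d ≤
        ((((box d N).sup fun x => ((box d N).filter fun w => ω ∈ inConn ↑(box d N) x w).card : ℕ) : ℝ))}ᶜ := by
    intro N
    rw [measureReal_compl (hmeas N), probReal_univ]; ring
  have hle : ∀ N : ℕ, μ.real {ω | ε * (2 * (N : ℝ) + 1) ^ d ≤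
      ((((box d N).sup fun x => ((box d N).filter fun w => ω ∈ inConn ↑(box d N) x w).card : ℕ) : ℝ))}ᶜ ≤
      μ.real {ω | ¬ ∃ x ∈ box d N, (θ - (θ - ε)) * (2 * (N : ℝ) + 1) ^ d ≤
        (((box d N).filter fun w => ω ∈ inConn ↑(box d N) x w).card : ℝ)} := by
    intro N
    refine measureReal_mono fun ω hω => ?_
    rintro ⟨x, hx, hxa⟩
    apply hω
    have hsup : (((box d N).filter fun w => ω ∈ inConn ↑(box d N) x w).card : ℝ) ≤
        ((((box d N).sup fun x => ((box d N).filter fun w => ω ∈ inConn ↑(box d N) x w).card : ℕ) : ℝ)) := by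
      exact_mod_cast Finset.le_sup (f := fun x => ((box d N).filter fun w => ω ∈ inConn ↑(box d N) x w).card) hx
    have : θ - (θ - ε) = ε := by ring
    rw [this] at hxa
    exact hxa.trans hsup
  have h0 : Tendsto (fun N : ℕ => μ.real {ω | ε * (2 * (N : ℝ) + 1) ^ d ≤
      ((((box d N).sup fun x => ((box d N).filter fun w => ω ∈ inConn ↑(box d N) x w).card : ℕ) : ℝ))}ᶜ) atTop (𝓝 0) :=
    squeeze_zero (fun N => measureReal_nonneg) hle h
  have h1 : Tendsto (fun N : ℕ => 1 - μ.real {ω | ε * (2 * (N : ℝ) + 1) ^ d ≤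
      ((((box d N).sup fun x => ((box d N).filter fun w => ω ∈ inConn ↑(box d N) x w).card : ℕ) : ℝ))}ᶜ) atTop (𝓝 1) := by
    have := h0.const_sub 1
    rw [sub_zero] at this
    exact this
  exact h1.congr fun N => (hcompl N).symm

/-! ## §3 The threshold of the in-box giant is `p_c(ℤ^d)` -/

open Classical in
/-- **THE FREE-BOUNDARY IN-BOX GIANT IS AN ORDER PARAMETER WITH THRESHOLD EXACTLY `p_c(ℤ^d)`** (`d ≥ 3`):
`(∃ ε > 0, ∃ c > 0, c ≤ P_p(ε(2N+1)^d ≤ M^in_N) for infinitely many N) ↔ p_c(ℤ^d) < p`.  "⇐": part IV (probability `→ 1` for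
`ε < θ(p)`, `θ(p) > 0` above `p_c`); "⇒": at or below `p_c` the probability `→ 0` (§1; AT `p_c` this is p205010).  builds on p205010
(kernel theorem, internal audit signed; external expert review pending). [cite: BorgsChayesKestenSpencer2001, Thm. 1.1]
[cite: KozmaNitzan2024, Thm. 6 with Conj. 3 (p. 15)] -/
theorem exists_frequently_le_real_supInBox_iff (hd : 3 ≤ d) (p : unitInterval) :
    (∃ ε : ℝ, 0 < ε ∧ ∃ c : ℝ, 0 < c ∧ ∃ᶠ N : ℕ in atTop, c ≤ (bondPercolation (zdGraph d) p).real
      {ω | ε * (2 * (N : ℝ) + 1) ^ d ≤ ((((box d N).sup fun x =>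
        ((box d N).filter fun w => ω ∈ inConn ↑(box d N) x w).card : ℕ) : ℝ))}) ↔
      criticalProb (zdGraph d) 0 < (p : ℝ) := by
  classical
  constructor
  · rintro ⟨ε, hε, c, hc, hfreq⟩
    by_contra hle
    push Not at hle
    have h0 := tendsto_real_le_supInBox_of_le_criticalProb (by omega) p hle hε
    have hev : ∀ᶠ N : ℕ in atTop, (bondPercolation (zdGraph d) p).real
        {ω | ε * (2 * (N : ℝ) + 1) ^ d ≤ ((((box d N).sup fun x =>
          ((box d N).filter fun w => ω ∈ inConn ↑(box d N) x w).card : ℕ) : ℝ))} < c :=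
      (tendsto_order.1 h0).2 c hc
    obtain ⟨N, hN1, hN2⟩ := (hfreq.and_eventually hev).exists
    linarith
  · intro hp
    have hθ : 0 < theta (zdGraph d) (0 : Site d) p := theta_pos_supercritical p (by rwa [coe_criticalProbI])
    refine ⟨theta (zdGraph d) (0 : Site d) p / 2, by positivity, 1 / 2, by norm_num, ?_⟩
    have h1 := tendsto_real_le_supInBox_supercritical hd p hp (ε := theta (zdGraph d) (0 : Site d) p / 2) (by linarith)
    exact ((tendsto_order.1 h1).1 (1 / 2) (by norm_num)).frequently.mono fun N hN => hN.le

end Rsw3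

end Summit.CriticalPhenomena.PercolationContinuityZ3.Theorems
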